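/-
Copyright (c) 2026. All rights reserved.
Released under Apache 2.0 license as described in the file LICENSE.
-/
import Literature.AlgebraicGeometry.ComplexMultiplication.HyperellipticJacobianDegenerateProductsOfNondegeneratePieces
import HarnessLib

/-!
# The SIMPLE factors of the degenerate pieces of `J_{48}` and `J_{40}`: `Y_{16} × Y_{48}` — a simple CM surface times a simple CM fourfold, dimension `6` — carries a rational `(2,2)`-class outside `𝓓²`; `E' × Y_{40}` — a CM elliptic curve times a simple CM fourfold, dimension `5` — is not stably nondegenerate; exceptional weights DESCEND along injective restriction to sub-pairs

Family `hodge`, cell `pub-hodgecm2` (COR-CM), KEPT Literature lane `lit-deligne-3` (generation 55, file F42; sequel of F40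
`HyperellipticJacobianExceptionalClassesLocated` — the located classes `{σ_1, σ_3} ⊔ {σ_{25}, σ_{31}}` on `X_{16} × X_{48}` and
`{σ_1, σ_3} ⊔ {σ_7, σ_{21}, σ_{23}, σ_{29}}` on `X_8 × X_{40}` — and of F41 `HyperellipticJacobianDegenerateProductsOfNondegeneratePieces` —
the pieces `X_d` are stably nondegenerate and orthogonal, their products are not).  THEOREMS ONLY: no definition, no named fact, no `sorry`,
no instance; D-0026 net debt `0`.  Nothing here asserts the algebraicity of any class; HC_CM is NOT proved.

THE QUESTION (g54/g55 outlook).  F40/F41 speak about the PIECES `X_d ⊨ (ℚ(ζ_d); Φ_d)` of `J_m = Jac(y² = x^m − 1)`, which for `4 ∣ d`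
are NOT simple: `X_d ∼ Y_d²` with `Y_d` SIMPLE, of complex multiplication by `ℚ(ζ_d − ζ_d^{−1})` (GGL Thm. 3.0 (5); the tree's
`exists_isogeny_sq_simple_of_four_dvd`).  What do the located classes say about the SIMPLE factors `E' = Y_8` (a CM elliptic curve,
`ℚ(ζ_8 − ζ_8^{−1}) = ℚ(√−2)`), `Y_{16}` (a simple CM surface, cyclic quartic CM field), `Y_{40}`, `Y_{48}` (simple CM fourfolds)?

THE PRINT.  B. Moonen, Yu. Zarhin, *Hodge classes on abelian varieties of low dimension*, Math. Ann. **315** (1999) 711–733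
[corpus: paper:arxiv-math_9901113, pp. 1–2, 6, 10–11]: §3 (3.1) «We may have that `Hg(X₁ × X₂) ≠ Hg(X₁) × Hg(X₂)` […] This holds if and only
if for some `m` and `n` the Hodge ring `B•(X₁^m × X₂^n)` is not generated by the elements coming from `B•(X₁^m)` and `B•(X₂^n)`»; Thm. (3.2)
(Hazama) «(1) Suppose `X₁` and `X₂` contain no factors of Type 4. Then `X₁ × X₂` again satisfies (D) […]»; Introduction (g) «`X` is isogenous
to a product `X₁ × X₂` where `X₁` is an elliptic curve with complex multiplication by an imaginary quadratic field `k` and where `X₂` is a simple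
abelian fourfold such that there exists an embedding `k ↪ End⁰(X₂)` via which `k` acts on `T_{X₂,0}` with multiplicities `(1,3)`» and Thm. 0.2 (3)
«Suppose we are in case (g). Then […] `B•(X) = D•(X)`. The Hodge group `Hg(X)` is strictly contained in `Sp_D(V,φ)`»; §5, Case 2 (p. 10):
«Rather than looking at `E × Y`, let us look at `Z := E² × Y` […] the corresponding space of Weil classes `W_k ⊂ H⁶(Z, ℚ)` consists of Hodge
classes»; and §5 (`d_min = 2`, p. 10): for `X ∼ Y₁ × Y₂`, `Y₁` a simple (CM) abelian SURFACE, `Y₂` a simple abelian THREEFOLD, «again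
`Hg(X) = Hg(Y₁) × Hg(Y₂)`».  B. B. Gordon, *A survey of the Hodge conjecture for abelian varieties* [corpus: paper:arxiv-alg-geom_9709030
p0020–p0021]: Thm. 7.5, Def. 7.6, 7.6.1, Thm. 7.6.2 (Hazama) and the remark «The difficulty with type (IV) arises in taking products of, or with,
abelian varieties of CM-type».  G. Shimura (1998) §6.2 Thm. 3 (a CM type induced from `(K₁; Φ₁)`, `[K : K₁] = h`: the variety is isogenous to
the `h`-th power of one of type `(K₁; Φ₁)`) and §8.2 Prop. 26; Gallese–Goodson–Lombardo (2024) §3 Thm. 3.0 (5) and §3.3 (`X_d ∼ Y_d²`,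
`Y_d` simple with CM by `ℚ(ζ_d − ζ_d^{−1})`, `4 ∣ d ∉ {4, 20, 24, 60}`… here `d ∈ {8, 16, 40, 48}`); Milne (2020) 1.2 (a),(c) and Gao–Ullmo (2025)
Thm. 3.1 (Pohlmann's theorem for a CM algebra: the tree's `exists_exceptional_biproduct_iff`).

THE MECHANISM FORMALISED (§§0–2).  For sub-pairs `(L_i; Ψ_i)` of `(K_i; Φ_i)` with `Ψ_i^{K_i} = Φ_i`, restriction
`res : ⊔_i Hom(K_i, ℂ) → ⊔_i Hom(L_i, ℂ)` preserves the Galois pattern of every point (`τσ ∈ Φ_i ⟺ τ(σ|_{L_i}) ∈ Ψ_i`).  Hence ANY injection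
`f : ⊔_i Hom(L_i, ℂ) ↪ ⊔_i Hom(K_i, ℂ)` over restriction carries balanced sets to balanced sets, balanced pairs to balanced pairs and disjoint
unions to disjoint unions, in both directions (§0, for arbitrary pattern-preserving injections between the index sets of two CM algebras;
the tree's `map_mem_disjointUnionsOf_iff`).  If a balanced NON-divisorial `2p`-set `W ⊆ ⊔_i Hom(K_i, ℂ)` has pairwise different restrictions,
a section `f` of `res` through `W` exists (§1: every embedding of `L_i` extends, the tree's `card_filter_comp_algebraMap_eq_finrank`), and
`f^{−1}(W)` is a balanced non-divisorial `2p`-subset of `⊔_i Hom(L_i, ℂ)` — an exceptional `(p,p)`-class on the product of realisations of the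
`(L_i; Ψ_i)`, i.e. of the SIMPLE factors when the `Ψ_i` are primitive.  For `K_i = ℚ(ζ_{d_i})` and `ζ − ζ^{−1} ∈ L_i` (§2): two embeddings
`σ_a, σ_b` agree on `ζ − ζ^{−1}` only if `a = b` or `a + b ≡ d/2 (mod d)` (`(μ^a − μ^b)(μ^{a+b} + 1) = 0`), so injectivity of `res` on a
two-member weight `W(P₁, P₂)` is a decidable certificate on residues (`injOn_restrict_weightPair`): for F40's weight on `X_{16} × X_{48}`,
`{1, 3} ⊂ (ℤ/16)ˣ` has `1 + 3 ≢ 8` and `{25, 31} ⊂ (ℤ/48)ˣ` has `25 + 31 ≢ 24` — it DESCENDS to `Y_{16} × Y_{48}`.  (F40's weight on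
`X_8 × X_{40}` does NOT descend to `E' × Y_{40}`: `{1, 3} ⊂ (ℤ/8)ˣ` has `1 + 3 ≡ 4` — both embeddings of `ℚ(ζ_8)` over ONE embedding of
`ℚ(√−2)`, matching Moonen–Zarhin's «`E² × Y`»; §4 reads that case through isogenies instead.)

WHAT IS PROVED.
* §0 `isGaloisBalancedAlg_map_iff_of_pattern`, `map_mem_pohlmannSetsAlg_iff_of_pattern`, `map_mem_pohlmannDivisorSetsAlg_iff_of_pattern`,
  `map_mem_diff_iff_of_pattern`, **`diff_nonempty_of_pattern`** (pattern-preserving injections between the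
  index sets of two CM algebras transport Pohlmann's sets, divisor sets and exceptional weights).
* §1 `exists_comp_algebraMap_eq`, `comp_mem_iff_of_restrict_eq`, `exists_embedding_restrict_eq`, **`diff_nonempty_subPair_of_injOn`** (an
  exceptional weight on which restriction to the sub-pairs is injective descends).
* §2 `expOf_eq_or_add_mod_eq_of_apply_eq` (`σ_a|_{ℚ(ζ−ζ^{−1})} = σ_b|` ⟹ `a = b ∨ a + b ≡ d/2`), **`injOn_restrict_weightPair`** (certificate form).
* §3 `exists_simpleFactor_retract` (`Y_d`, its primitive sub-pair `(ℚ(ζ_d − ζ_d^{−1}); Ψ)` of index `2`, `A ∼ Y_d²`, a quasi-retraction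
  `t ≫ h = [N]`), **`exists_simpleFactors_exceptional_of_lev_eq_sixteen_fortyEight`** — for realisations `A_0, A_1` of the lower-half types at levels
  `16, 48`: simple factors `B_0` (dim `2`), `B_1` (dim `4`), `A_i ∼ B_i²`, both STABLY NONDEGENERATE (quasi-retracts of the `A_i`, F41 + the tree's
  `IsStablyNondegenerate.of_comp_eq_nsmul_id`), `Hom(B_0, B_1) = 0 = Hom(B_1, B_0)` (simple of different dimensions), an exceptional weight of
  `(L_0; Ψ_0) ⊔ (L_1; Ψ_1)` in degree `2`, a rational `(2,2)`-class outside `𝓓² ⊗ ℂ` on `B_0 ⊕ B_1` AND on `B_0 × B_1` (dimension `6`), neither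
  divisor-generated nor stably nondegenerate.
* §4 **`exists_simpleFactors_of_lev_eq_eight_forty`** — levels `8, 40`: simple factors `B_0` (a CM elliptic curve), `B_1` (a simple CM fourfold),
  stably nondegenerate, orthogonal, `B_0 × B_1` (dimension `5`) NOT stably nondegenerate (`B_0² × B_1² ∼ A_0 × A_1` and F41; the tree's
  `IsStablyNondegenerate.powSucc_prod_powSucc`, `.of_isIsogenous`).
* §5 hypothesis-free: **`exists_cmCurve_simple_fourfold_not_isStablyNondegenerate_prod`** (dimension `5`),
  **`exists_simple_surface_fourfold_exceptional_prod`** (dimension `6`, with the `(2,2)`-class on the product),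
  **`not_forall_isSimple_isStablyNondegenerate_prod`** (Hazama's «no type-(IV) factor» hypothesis — in the tree's named fact
  `Hazama1989_stablyNondegenerate_prod` and in its PROVED form `IsStablyNondegenerate.prod_of_dim_le_seven` — cannot be dropped even for SIMPLE,
  mutually orthogonal factors of dimensions `1` and `4`), `not_forall_isSimple_surface_fourfold_codimTwo` (nor `B² = D²` kept for dimensions `2`, `4`).

HONEST.  Assembled from tree theorems (F40's located weights and certificates, F41's stable nondegeneracy of the pieces, GGL Thm. 3.0 (5) as
`exists_isogeny_sq_simple_of_four_dvd`, Pohlmann's dictionary for CM algebras, the retraction ∕ isogeny calculus of condition (D)); new here is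
only the elementary transport §§0–2.  The dimension-`5` example is Moonen–Zarhin's case (g) made explicit inside `J_{40}` (we do NOT formalise
`k ↪ End⁰(Y_{40})`, the multiplicities `(1,3)`, nor their `B•(E × Y) = D•(E × Y)`); the dimension-`6` example `Y_{16} × Y_{48}` with `B² ≠ D²`
ON THE PRODUCT of a simple CM surface and a simple CM fourfold was not found in print (presearch: corpus hybrid ∕ vector «simple abelian surface
times simple fourfold, complex multiplication, exceptional Hodge class, Hodge group of a product», galaxy «Hodge group of a product|exceptional
Hodge classes on products|stably nondegenerate»: Deligne–Milne–Ogus–Shih pp. 53–55, van Geemen LNM 1594 pp. 214–215, Green–Griffiths–Kerr — general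
theory only); Moonen–Zarhin's classification stops at dimension `5`, where a simple CM surface times a simple threefold has `Hg = Hg(Y₁) × Hg(Y₂)`.
No numerics are used; no algebraicity claim is made.

## References
* [MoonenZarhin1999LowDim] B. Moonen, Yu. Zarhin, Math. Ann. 315 (1999) 711–733: Introduction (g), Thm. 0.2 (3)–(4), §3 (3.1), Thm. (3.2),
  Prop. (3.8), §5 (5.9)–(5.11) [corpus: paper:arxiv-math_9901113 pp. 1–2, 6, 10–11].
  [cite: MoonenZarhin1999LowDim, Thm. 0.2 (3), §3 (3.1)–(3.2), Prop. (3.8) and §5 (5.9)–(5.11)]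
* [Gordon1999HodgeAVSurvey] B. B. Gordon, *A survey of the Hodge conjecture for abelian varieties*, Thm. 7.5, Def. 7.6, 7.6.1, Thm. 7.6.2 and the
  remark following it; 9.2.2, §9.3 [corpus: paper:arxiv-alg-geom_9709030 p0020–p0021, p0025]. [cite: Gordon1999HodgeAVSurvey, Thm. 7.6.2 and 7.6.1]
* [Hazama1989] F. Hazama, Duke Math. J. 58 (1989) 31–37. [cite: Hazama1989, Thm. (= Gordon 7.6.2)]
* [Shimura1998] G. Shimura, *Abelian Varieties with Complex Multiplication and Modular Functions* (1998), §6.2 Thm. 3, §8.2 Prop. 26.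
  [cite: Shimura1998, §6.2 Thm. 3 and §8.2 Prop. 26]
* [GalleseGoodsonLombardo2024] Gallese–Goodson–Lombardo, §3 Thm. 3.0 (5), §3.3, Lemma 11–12 [corpus: paper:arxiv-2405.20394 pp. 3–5].
  [cite: GalleseGoodsonLombardo2024, §3 Thm. 3.0 (5) and §3.3]
* [Milne2020HodgeClassesAV] J. S. Milne, *Hodge classes on abelian varieties* (2020), 1.2 (a),(c). [cite: Milne2020HodgeClassesAV, 1.2 (c)]
* [GaoUllmo2025] Z. Gao, E. Ullmo, Thm. 3.1 (Pohlmann for CM algebras). [cite: GaoUllmo2025, Thm. 3.1]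
* [Pohlmann1968] H. Pohlmann, Ann. of Math. (2) 88 (1968) 161–180, Thm. 1. [cite: Pohlmann1968, Thm. 1]
* [vanGeemen1994HodgeAV] B. van Geemen, LNM 1594 (1994), §2.4–2.5, §3.6–3.7. [cite: vanGeemen1994HodgeAV, §2.4 and §3.6–3.7]
* [MumfordAV1970] D. Mumford, *Abelian Varieties*, §19 Thm. 1 and Cor. 2. [cite: MumfordAV1970, §19 Thm. 1]
* [Washington1997] L. Washington, *Introduction to Cyclotomic Fields*, Thm. 2.5. [cite: Washington1997, Thm. 2.5]
* [Streng2010] M. Streng, thesis (2010), Ch. I Def. 3.2 (induced CM types). [cite: Streng2010, Ch. I Def. 3.2]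
-/

open CategoryTheory CategoryTheory.Limits NumberField Module

namespace Literature.AlgebraicGeometry.ComplexMultiplication

open Literature.AlgebraicGeometry.Motives
open Literature.AlgebraicGeometry.Motives.AbelianVariety
open Literature.AlgebraicGeometry.HodgeTheory (complexBetti IsRationalClass IsOfHodgeType IsStablyNondegenerate
  IsDivisorGenerated HodgeConjectureFor)
open Literature.AlgebraicGeometry.VanGeemen1994 (hodgeClassSpan)
open Literature.Barriers.HodgeConjecture (divisorClassesSpan)
open Literature.NumberTheory.ComplexMultiplication

namespace HyperellipticJacobian

open Literature.AlgebraicGeometry.Pohlmann1968 Literature.AlgebraicGeometry.Pohlmann1968.Cyclotomic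
open Literature.AlgebraicGeometry.Pohlmann1968.CMAlgebra

/-! ## §0 Pattern-preserving injections between the index sets of two CM algebras transport Pohlmann's index sets -/

section Pattern

variable {n n' : ℕ} {K : Fin n → Type} [∀ i, Field (K i)] {F : Fin n' → Type} [∀ j, Field (F j)]
  {Φ : ∀ i, CMType (K i)} {Ψ : ∀ j, CMType (F j)}
  (f : ((j : Fin n') × (F j →+* ℂ)) ↪ ((i : Fin n) × (K i →+* ℂ)))
  (hf : ∀ (τ : ℂ ≃+* ℂ) (y : (j : Fin n') × (F j →+* ℂ)),
    (τ : ℂ →+* ℂ).comp (f y).2 ∈ (Φ (f y).1).1 ↔ (τ : ℂ →+* ℂ).comp y.2 ∈ (Ψ y.1).1)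

/-- Along an injection `f` with `Q (f y) ⟺ R y`, the members `x` of `f(T)` with `Q x` are the images of the members `y` of `T`
with `R y`, so the counts agree. [folklore] -/
private theorem ncard_sep_map_eq_of_iff (T : Finset ((j : Fin n') × (F j →+* ℂ)))
    {Q : ((i : Fin n) × (K i →+* ℂ)) → Prop} {R : ((j : Fin n') × (F j →+* ℂ)) → Prop} (hQR : ∀ y, Q (f y) ↔ R y) :
    {x | x ∈ T.map f ∧ Q x}.ncard = {y | y ∈ T ∧ R y}.ncard := by
  have hset : {x | x ∈ T.map f ∧ Q x} = f '' {y | y ∈ T ∧ R y} := by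
    ext x
    simp only [Set.mem_setOf_eq, Set.mem_image, Finset.mem_map]
    constructor
    · rintro ⟨⟨y, hy, rfl⟩, hQ⟩
      exact ⟨y, ⟨hy, (hQR y).1 hQ⟩, rfl⟩
    · rintro ⟨y, ⟨hy, hR⟩, rfl⟩
      exact ⟨⟨y, hy, rfl⟩, (hQR y).2 hR⟩
  rw [hset, Set.ncard_image_of_injective _ f.injective]

include hf in
/-- **Milne's condition 1.2 (c) is transported along a pattern-preserving injection** `f : ⊔_j Hom(F_j, ℂ) ↪ ⊔_i Hom(K_i, ℂ)`
(`τ ∘ f(y) ∈ Φ ⟺ τ ∘ y ∈ Ψ` for all `τ ∈ Aut(ℂ)`): `f(T)` is balanced for `(Φ_i)_i` iff `T` is balanced for `(Ψ_j)_j`.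
[cite: Milne2020HodgeClassesAV, 1.2 (c)] [cite: GaoUllmo2025, Thm. 3.1 (3.2)] [cite: Shimura1998, §6.2 Thm. 3] -/
theorem isGaloisBalancedAlg_map_iff_of_pattern (T : Finset ((j : Fin n') × (F j →+* ℂ))) :
    IsGaloisBalancedAlg Φ (T.map f) ↔ IsGaloisBalancedAlg Ψ T := by
  rw [isGaloisBalancedAlg_iff, isGaloisBalancedAlg_iff]
  refine forall_congr' fun τ => ?_
  rw [ncard_sep_map_eq_of_iff f T (Q := fun x => (τ : ℂ →+* ℂ).comp x.2 ∈ (Φ x.1).1)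
      (R := fun y => (τ : ℂ →+* ℂ).comp y.2 ∈ (Ψ y.1).1) (hf τ),
    ncard_sep_map_eq_of_iff f T (Q := fun x => (τ : ℂ →+* ℂ).comp x.2 ∉ (Φ x.1).1)
      (R := fun y => (τ : ℂ →+* ℂ).comp y.2 ∉ (Ψ y.1).1) fun y => not_congr (hf τ y)]

include hf in
/-- **`f(T) ∈ pohlmannSetsAlg Φ p ⟺ T ∈ pohlmannSetsAlg Ψ p`** along a pattern-preserving injection.
[cite: Milne2020HodgeClassesAV, 1.2 (c)] [cite: GaoUllmo2025, Thm. 3.1] -/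
theorem map_mem_pohlmannSetsAlg_iff_of_pattern (p : ℕ) (T : Finset ((j : Fin n') × (F j →+* ℂ))) :
    T.map f ∈ pohlmannSetsAlg Φ p ↔ T ∈ pohlmannSetsAlg Ψ p := by
  rw [mem_pohlmannSetsAlg_iff, mem_pohlmannSetsAlg_iff, Finset.card_map, isGaloisBalancedAlg_map_iff_of_pattern f hf]

include hf in
/-- **`f(T) ∈ pohlmannDivisorSetsAlg Φ p ⟺ T ∈ pohlmannDivisorSetsAlg Ψ p`** (balanced pairs to balanced pairs, disjoint unions to
disjoint unions; the tree's `map_mem_disjointUnionsOf_iff`). [cite: Gordon1999HodgeAVSurvey, 9.2.2] [cite: vanGeemen1994HodgeAV, §2.4] -/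
theorem map_mem_pohlmannDivisorSetsAlg_iff_of_pattern (p : ℕ) (T : Finset ((j : Fin n') × (F j →+* ℂ))) :
    T.map f ∈ pohlmannDivisorSetsAlg Φ p ↔ T ∈ pohlmannDivisorSetsAlg Ψ p := by
  rw [pohlmannDivisorSetsAlg_def, pohlmannDivisorSetsAlg_def]
  exact map_mem_disjointUnionsOf_iff f (fun t => map_mem_pohlmannSetsAlg_iff_of_pattern f hf 1 t) p T

include hf in
/-- **Exceptional weights correspond**: `f(T)` is a balanced `2p`-set that is not a disjoint union of balanced pairs iff `T` is.
[cite: Gordon1999HodgeAVSurvey, 9.2.2 and §9.3] [cite: GaoUllmo2025, Thm. 3.1] -/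
theorem map_mem_diff_iff_of_pattern (p : ℕ) (T : Finset ((j : Fin n') × (F j →+* ℂ))) :
    T.map f ∈ pohlmannSetsAlg Φ p \ pohlmannDivisorSetsAlg Φ p ↔ T ∈ pohlmannSetsAlg Ψ p \ pohlmannDivisorSetsAlg Ψ p := by
  rw [Set.mem_sdiff, Set.mem_sdiff, map_mem_pohlmannSetsAlg_iff_of_pattern f hf, map_mem_pohlmannDivisorSetsAlg_iff_of_pattern f hf]

/-- A weight inside the range of `f` is the image of a weight. [folklore] -/
private theorem exists_map_eq_of_forall_mem_range (W : Finset ((i : Fin n) × (K i →+* ℂ))) (hW : ∀ x ∈ W, x ∈ Set.range f) :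
    ∃ T : Finset ((j : Fin n') × (F j →+* ℂ)), T.map f = W := by
  classical
  refine ⟨W.preimage f f.injective.injOn, ?_⟩
  rw [Finset.map_eq_image, Finset.image_preimage]
  exact Finset.filter_true_of_mem hW

include hf in
/-- **An exceptional weight of `(∏_i K_i; (Φ_i))` lying in the range of a pattern-preserving injection from `⊔_j Hom(F_j, ℂ)` is an
exceptional weight of `(∏_j F_j; (Ψ_j))`.** [cite: Gordon1999HodgeAVSurvey, 9.2.2 and §9.3] [cite: GaoUllmo2025, Thm. 3.1] -/
theorem diff_nonempty_of_pattern {p : ℕ} {W : Finset ((i : Fin n) × (K i →+* ℂ))}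
    (hW : W ∈ pohlmannSetsAlg Φ p \ pohlmannDivisorSetsAlg Φ p) (hsub : ∀ x ∈ W, x ∈ Set.range f) :
    (pohlmannSetsAlg Ψ p \ pohlmannDivisorSetsAlg Ψ p).Nonempty := by
  obtain ⟨T, hT⟩ := exists_map_eq_of_forall_mem_range f W hsub
  exact ⟨T, (map_mem_diff_iff_of_pattern f hf p T).1 (hT ▸ hW)⟩

end Pattern

/-! ## §1 Restriction to sub-pairs inducing the types: an exceptional weight on which restriction is injective descends -/

section SubPair

variable {n : ℕ} {K : Fin n → Type} [∀ i, Field (K i)] [∀ i, NumberField (K i)] {Φ : ∀ i, CMType (K i)}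
  {L : ∀ i, IntermediateField ℚ (K i)} {Ψ : ∀ i, CMType (L i)}

/-- Every complex embedding of a subfield `L_i ⊆ K_i` of a number field extends to `K_i` (the fibres of restriction have
`[K_i : L_i] > 0` elements, the tree's `card_filter_comp_algebraMap_eq_finrank`). [cite: Shimura1998, §6.2 Thm. 3 (proof)] -/
theorem exists_comp_algebraMap_eq (L : ∀ i, IntermediateField ℚ (K i)) (i : Fin n) (ρ : L i →+* ℂ) :
    ∃ σ : K i →+* ℂ, σ.comp (algebraMap (L i) (K i)) = ρ := by
  classical
  have hpos : 0 < (Finset.univ.filter fun σ : K i →+* ℂ => σ.comp (algebraMap (L i) (K i)) = ρ).card := by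
    rw [card_filter_comp_algebraMap_eq_finrank (K := K i) (K₁ := L i) ρ]
    exact Module.finrank_pos
  obtain ⟨σ, hσ⟩ := Finset.card_pos.1 hpos
  exact ⟨σ, (Finset.mem_filter.1 hσ).2⟩

/-- **`τσ ∈ Ψ_i^{K_i} ⟺ τ(σ|_{L_i}) ∈ Ψ_i`**: restriction to the sub-pairs preserves the pattern of every point.
[cite: Shimura1998, §6.2 Thm. 3] [cite: Streng2010, Ch. I Def. 3.2] -/
theorem comp_mem_iff_of_restrict_eq (hind : ∀ i, inducedCMType (algebraMap (L i) (K i)) (Ψ i) = Φ i)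
    (τ : ℂ ≃+* ℂ) (x : (i : Fin n) × (K i →+* ℂ)) {y : (i : Fin n) × (L i →+* ℂ)}
    (hxy : (⟨x.1, x.2.comp (algebraMap (L x.1) (K x.1))⟩ : (i : Fin n) × (L i →+* ℂ)) = y) :
    (τ : ℂ →+* ℂ).comp x.2 ∈ (Φ x.1).1 ↔ (τ : ℂ →+* ℂ).comp y.2 ∈ (Ψ y.1).1 := by
  subst hxy
  rw [← hind x.1, comp_mem_inducedCMType_iff]

/-- **A SECTION OF RESTRICTION THROUGH A GIVEN WEIGHT.**  If restriction `(i, σ) ↦ (i, σ|_{L_i})` is injective on the weight `W`,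
there is an injection `f : ⊔_i Hom(L_i, ℂ) ↪ ⊔_i Hom(K_i, ℂ)` over restriction (`f(y)|_L = y`) whose range contains `W` (choose the
preimage in `W` when there is one, any extension otherwise). [cite: Shimura1998, §6.2 Thm. 3 (proof)] -/
theorem exists_embedding_restrict_eq (L : ∀ i, IntermediateField ℚ (K i)) (W : Finset ((i : Fin n) × (K i →+* ℂ)))
    (hinj : Set.InjOn (fun x : (i : Fin n) × (K i →+* ℂ) =>
      (⟨x.1, x.2.comp (algebraMap (L x.1) (K x.1))⟩ : (i : Fin n) × (L i →+* ℂ))) ↑W) :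
    ∃ f : ((i : Fin n) × (L i →+* ℂ)) ↪ ((i : Fin n) × (K i →+* ℂ)),
      (∀ y, (⟨(f y).1, (f y).2.comp (algebraMap (L (f y).1) (K (f y).1))⟩ : (i : Fin n) × (L i →+* ℂ)) = y) ∧
      ∀ x ∈ W, x ∈ Set.range f := by
  classical
  set r : ((i : Fin n) × (K i →+* ℂ)) → ((i : Fin n) × (L i →+* ℂ)) :=
    fun x => ⟨x.1, x.2.comp (algebraMap (L x.1) (K x.1))⟩ with hr
  have hext : ∀ y : (i : Fin n) × (L i →+* ℂ), ∃ x, r x = y := by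
    rintro ⟨i, ρ⟩
    obtain ⟨σ, hσ⟩ := exists_comp_algebraMap_eq L i ρ
    exact ⟨⟨i, σ⟩, by simp only [hr, hσ]⟩
  let g : ((i : Fin n) × (L i →+* ℂ)) → ((i : Fin n) × (K i →+* ℂ)) := fun y =>
    if h : ∃ x ∈ W, r x = y then h.choose else (hext y).choose
  have hg : ∀ y, r (g y) = y := fun y => by
    by_cases h : ∃ x ∈ W, r x = y
    · simp only [g, dif_pos h]
      exact h.choose_spec.2
    · simp only [g, dif_neg h]
      exact (hext y).choose_spec
  have hginj : Function.Injective g := fun y y' h => by rw [← hg y, ← hg y', h]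
  refine ⟨⟨g, hginj⟩, hg, fun x hx => ⟨r x, ?_⟩⟩
  have h : ∃ x' ∈ W, r x' = r x := ⟨x, hx, rfl⟩
  show g (r x) = x
  simp only [g, dif_pos h]
  exact hinj h.choose_spec.1 hx h.choose_spec.2

/-- **AN EXCEPTIONAL WEIGHT ON WHICH RESTRICTION IS INJECTIVE DESCENDS TO THE SUB-PAIRS.**  For sub-pairs `(L_i; Ψ_i)` of
`(K_i; Φ_i)` with `Ψ_i^{K_i} = Φ_i`: a balanced, non-divisorial `2p`-subset `W ⊆ ⊔_i Hom(K_i, ℂ)` whose points have pairwise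
different restrictions is the lift of a balanced, non-divisorial `2p`-subset of `⊔_i Hom(L_i, ℂ)` — an exceptional `(p,p)`-class on
the product of realisations of the `(L_i; Ψ_i)` (the SIMPLE factors when the `Ψ_i` are primitive).
[cite: Shimura1998, §6.2 Thm. 3 and §8.2 Prop. 26] [cite: Gordon1999HodgeAVSurvey, 9.2.2 and §9.3] [cite: GaoUllmo2025, Thm. 3.1] -/
theorem diff_nonempty_subPair_of_injOn (hind : ∀ i, inducedCMType (algebraMap (L i) (K i)) (Ψ i) = Φ i) {p : ℕ}
    {W : Finset ((i : Fin n) × (K i →+* ℂ))} (hW : W ∈ pohlmannSetsAlg Φ p \ pohlmannDivisorSetsAlg Φ p)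
    (hinj : Set.InjOn (fun x : (i : Fin n) × (K i →+* ℂ) =>
      (⟨x.1, x.2.comp (algebraMap (L x.1) (K x.1))⟩ : (i : Fin n) × (L i →+* ℂ))) ↑W) :
    (pohlmannSetsAlg Ψ p \ pohlmannDivisorSetsAlg Ψ p).Nonempty := by
  obtain ⟨f, hf, hW'⟩ := exists_embedding_restrict_eq L W hinj
  exact diff_nonempty_of_pattern f (fun τ y => comp_mem_iff_of_restrict_eq hind τ (f y) (hf y)) hW hW'

end SubPair

/-! ## §2 Cyclotomic members: two embeddings of `ℚ(ζ_d)` agreeing on `ζ_d − ζ_d^{−1}` have exponents `a = b` or `a + b ≡ d/2 (mod d)` -/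

section ZetaSubInv

variable {d : ℕ} [NeZero d] {K : Type} [Field K] [NumberField K] [IsCyclotomicExtension {d} ℚ K]

/-- **Embeddings agreeing on `ζ_d − ζ_d^{−1}`**: if `σ(ζ − ζ^{−1}) = σ'(ζ − ζ^{−1})` then, with `σζ = μ^a`, `σ'ζ = μ^b`
(`μ = e^{2πi/d}`), `(μ^a − μ^b)(μ^{a+b} + 1) = 0`, so `a = b` or `μ^{a+b} = −1`, i.e. `a + b ≡ d/2 (mod d)` (`d` even) — the two
embeddings over one embedding of `ℚ(ζ_d − ζ_d^{−1})` are `σ` and `σ ∘ (ζ ↦ −ζ^{−1})`. [cite: GalleseGoodsonLombardo2024, §3.3]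
[cite: Shimura1998, §8.2 Prop. 26 (proof)] [cite: Washington1997, Thm. 2.5] -/
theorem expOf_eq_or_add_mod_eq_of_apply_eq (h2 : 2 ∣ d) {σ σ' : K →+* ℂ}
    (h : σ (zetaOf d K - (zetaOf d K)⁻¹) = σ' (zetaOf d K - (zetaOf d K)⁻¹)) :
    expOf d K σ' = expOf d K σ ∨ ((expOf d K σ).val + (expOf d K σ').val) % d = d / 2 := by
  have hμ : IsPrimitiveRoot (rootζ d) d := isPrimitiveRoot_rootζ' d
  have hd0 : d ≠ 0 := NeZero.ne d
  set a := (expOf d K σ).val with ha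
  set b := (expOf d K σ').val with hb
  rw [map_sub, map_inv₀, map_sub, map_inv₀, expOf_spec d K σ, expOf_spec d K σ'] at h
  set x : ℂ := rootζ d ^ (expOf d K σ).val with hx
  set y : ℂ := rootζ d ^ (expOf d K σ').val with hy
  have hx0 : x ≠ 0 := pow_ne_zero _ (hμ.ne_zero hd0)
  have hy0 : y ≠ 0 := pow_ne_zero _ (hμ.ne_zero hd0)
  have hx1 : x * x⁻¹ = 1 := mul_inv_cancel₀ hx0
  have hy1 : y * y⁻¹ = 1 := mul_inv_cancel₀ hy0
  have key : (x - y) * (x * y + 1) = 0 := by linear_combination (x * y) * h + y * hx1 - x * hy1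
  rcases mul_eq_zero.1 key with hxy | hxy
  · left
    apply ZMod.val_injective
    exact (hμ.pow_inj (ZMod.val_lt _) (ZMod.val_lt _) (sub_eq_zero.1 hxy)).symm
  · right
    have hm1 : x * y = -1 := eq_neg_of_add_eq_zero_left hxy
    have hpow : rootζ d ^ (a + b) = -1 := by rw [pow_add]; exact hm1
    have hsq : rootζ d ^ ((a + b) * 2) = 1 := by rw [pow_mul, hpow]; norm_num
    have hdvd : d ∣ (a + b) * 2 := (hμ.pow_eq_one_iff_dvd _).1 hsq
    have hndvd : ¬d ∣ a + b := fun hab => by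
      have h1 : rootζ d ^ (a + b) = 1 := (hμ.pow_eq_one_iff_dvd _).2 hab
      rw [hpow] at h1
      norm_num at h1
    obtain ⟨e, rfl⟩ := h2
    obtain ⟨q, hq⟩ := hdvd
    have hab : a + b = e * q := by
      have : 2 * (a + b) = 2 * (e * q) := by rw [mul_comm 2 (a + b), hq]; ring
      omega
    have hqodd : q % 2 = 1 := by
      by_contra hev
      apply hndvd
      refine ⟨q / 2, ?_⟩
      rw [hab]
      have : q = 2 * (q / 2) := by omega
      conv_lhs => rw [this]
      ring
    have he : (2 * e) / 2 = e := by omega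
    rw [he, hab]
    have hq' : e * q = e + 2 * e * (q / 2) := by
      have : q = 2 * (q / 2) + 1 := by omega
      conv_lhs => rw [this]
      ring
    rw [hq', Nat.add_mul_mod_self_left]
    exact Nat.mod_eq_of_lt (by omega)

end ZetaSubInv

/-! ### Injectivity of restriction on a two-member weight, certificate form -/

section InjOn

variable {k : ℕ} {lev : Fin k → ℕ} [∀ i, NeZero (lev i)] {K : Fin k → Type} [∀ i, Field (K i)]
  [∀ i, NumberField (K i)] [∀ i, IsCyclotomicExtension {lev i} ℚ (K i)] {M : ℕ} [NeZero M]
  {L : ∀ i, IntermediateField ℚ (K i)}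

omit [NeZero M] in
/-- **RESTRICTION IS INJECTIVE ON THE WEIGHT `W(P₁, P₂)`, CERTIFICATE FORM.**  If `ζ_{d_i} − ζ_{d_i}^{−1} ∈ L_i` for all members and no two
DIFFERENT exponents `e ≠ e'` selected by `P_j` on the level `d_j` satisfy `e + e' ≡ d_j/2 (mod d_j)` (`j = 1, 2`), then the points of
`W(P₁, P₂)` have pairwise different restrictions to the `L_i`. [cite: GalleseGoodsonLombardo2024, §3.3] [cite: Shimura1998, §8.2 Prop. 26] -/
theorem injOn_restrict_weightPair (h2 : ∀ i, 2 ∣ lev i)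
    (hζ : ∀ i, zetaOf (lev i) (K i) - (zetaOf (lev i) (K i))⁻¹ ∈ L i)
    {i₁ i₂ : Fin k} (hne : i₁ ≠ i₂) {d₁ d₂ : ℕ} [NeZero d₁] [NeZero d₂] (h₁ : lev i₁ = d₁) (h₂ : lev i₂ = d₂)
    (P₁ P₂ : ZMod M → Prop) [DecidablePred P₁] [DecidablePred P₂]
    (hs₁ : ∀ e e' : ZMod d₁, e.val.Coprime d₁ → e'.val.Coprime d₁ → P₁ ((M / d₁ * e.val : ℕ) : ZMod M) →
      P₁ ((M / d₁ * e'.val : ℕ) : ZMod M) → e ≠ e' → (e.val + e'.val) % d₁ ≠ d₁ / 2)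
    (hs₂ : ∀ e e' : ZMod d₂, e.val.Coprime d₂ → e'.val.Coprime d₂ → P₂ ((M / d₂ * e.val : ℕ) : ZMod M) →
      P₂ ((M / d₂ * e'.val : ℕ) : ZMod M) → e ≠ e' → (e.val + e'.val) % d₂ ≠ d₂ / 2) :
    Set.InjOn (fun x : (i : Fin k) × (K i →+* ℂ) =>
        (⟨x.1, x.2.comp (algebraMap (L x.1) (K x.1))⟩ : (i : Fin k) × (L i →+* ℂ)))
      ↑(Finset.univ.filter fun x : (i : Fin k) × (K i →+* ℂ) =>
        (x.1 = i₁ ∧ P₁ ((M / lev x.1 * (expOf (lev x.1) (K x.1) x.2).val : ℕ) : ZMod M)) ∨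
        (x.1 = i₂ ∧ P₂ ((M / lev x.1 * (expOf (lev x.1) (K x.1) x.2).val : ℕ) : ZMod M))) := by
  classical
  subst h₁
  subst h₂
  rintro ⟨i, σ⟩ hx ⟨i', σ'⟩ hx' hres
  rw [Finset.coe_filter, Set.mem_setOf_eq] at hx hx'
  simp only [Sigma.mk.inj_iff] at hres
  obtain ⟨hii, hheq⟩ := hres
  subst hii
  have hcomp := eq_of_heq hheq
  have happ : σ (zetaOf (lev i) (K i) - (zetaOf (lev i) (K i))⁻¹) = σ' (zetaOf (lev i) (K i) - (zetaOf (lev i) (K i))⁻¹) := by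
    have := RingHom.congr_fun hcomp ⟨_, hζ i⟩
    simpa using this
  by_cases he : expOf (lev i) (K i) σ' = expOf (lev i) (K i) σ
  · rw [expOf_injective (lev i) (K i) he]
  · exfalso
    have hmod := (expOf_eq_or_add_mod_eq_of_apply_eq (h2 i) happ).resolve_left he
    rcases hx.2 with ⟨hi, hP⟩ | ⟨hi, hP⟩ <;> rcases hx'.2 with ⟨hi', hP'⟩ | ⟨hi', hP'⟩
    · subst hi
      exact hs₁ _ _ (coprime_expOf _ _ σ) (coprime_expOf _ _ σ') hP hP' (fun h => he h.symm) hmod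
    · exact hne (hi.symm.trans hi')
    · exact hne (hi'.symm.trans hi)
    · subst hi
      exact hs₂ _ _ (coprime_expOf _ _ σ) (coprime_expOf _ _ σ') hP hP' (fun h => he h.symm) hmod

end InjOn

/-! ## §3 The simple factors `Y_{16}` (a CM surface) and `Y_{48}` (a CM fourfold) of `J_{48}`: an exceptional `(2,2)`-class on `Y_{16} × Y_{48}` -/

section SimpleFactors

/-- **The simple factor `Y_d` of `X_d ∼ Y_d²` with its quasi-retraction** (`4 ∣ d ≥ 8`, `d ∉ {20, 24, 60}`): a primitive sub-pair
`(L; Ψ)`, `L = ℚ(ζ_d − ζ_d^{−1})` of index `2`, `Ψ^{ℚ(ζ_d)} = Φ_d`, a SIMPLE realisation `B ⊨ (L; Ψ)` with `4 dim B = φ(d)`, and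
homomorphisms `t : B → A`, `h : A → B` with `t ≫ h = [N]`, `N ≠ 0` (from the isogeny `A → B × B` and a quasi-inverse).
[cite: GalleseGoodsonLombardo2024, §3 Thm. 3.0 (5) and §3.3] [cite: Shimura1998, §6.2 Thm. 3 and §8.2 Prop. 26] [cite: MumfordAV1970, §19 Thm. 1] -/
theorem exists_simpleFactor_retract {d : ℕ} [NeZero d] {K : Type} [Field K] [NumberField K] [IsCyclotomicExtension {d} ℚ K]
    {Φ : CMType K} {A : AbelianVariety ℂ} {ι : 𝓞 K →+* End A} {θ : K →+* Module.End ℂ (complexBetti A.X 1)}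
    (h4 : 4 ∣ d) (h8 : 8 ≤ d) (h20 : d ≠ 20) (h24 : d ≠ 24) (h60 : d ≠ 60)
    (hΦ : ∀ σ : K →+* ℂ, σ ∈ Φ.1 ↔ 2 * (expOf d K σ).val < d) (hA : IsCMTypeRealisation Φ A ι θ) :
    ∃ (L : IntermediateField ℚ K) (Ψ : CMType L) (B : AbelianVariety ℂ) (ιB : 𝓞 L →+* End B)
      (θB : L →+* Module.End ℂ (complexBetti B.X 1)) (t : B ⟶ A) (h : A ⟶ B) (N : ℕ),
      inducedCMType (algebraMap L K) Ψ = Φ ∧ Module.finrank L K = 2 ∧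
        L = IntermediateField.adjoin ℚ {zetaOf d K - (zetaOf d K)⁻¹} ∧ zetaOf d K - (zetaOf d K)⁻¹ ∈ L ∧
        IsCMTypeRealisation Ψ B ιB θB ∧ B.IsSimple ∧ 4 * B.dim = Nat.totient d ∧ IsIsogenous A (⨁ fun _ : Fin 2 => B) ∧
        N ≠ 0 ∧ t ≫ h = N • 𝟙 B := by
  obtain ⟨-, L, Ψ, B, ιB, θB, -, hind, hfin, hL, hB, hs, hdim, P, π, hP, g, hg, -⟩ :=
    exists_isogeny_sq_simple_of_four_dvd h4 h8 h20 h24 h60 Φ hΦ hA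
  have hiso : IsIsogenous A (⨁ fun _ : Fin 2 => B) := isIsogenous_biproduct_const_of_isLimit_fan hP hg
  obtain ⟨t, h, N, hN, hth⟩ := AndreRiemann.avDominatedBy_of_isIsogenous_pow (m := 2) two_pos hiso.symm'
  refine ⟨L, Ψ, B, ιB, θB, t, h, N, hind, hfin, hL, ?_, hB, hs, hdim, hiso, hN, hth⟩
  rw [hL]
  exact IntermediateField.subset_adjoin ℚ _ (Set.mem_singleton _)

/-- Stable nondegeneracy passes from `P 0 × P 1` to the biproduct `⨁_{i : Fin 2} P i` (`(π₀, π₁) ≫ (fst ≫ ι₀ + snd ≫ ι₁) = 𝟙`), and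
exceptional classes ∕ failure of `B = D` pass from the biproduct to the product. [cite: Gordon1999HodgeAVSurvey, 7.6.1] -/
private theorem prod_of_biproduct_two (P : Fin 2 → AbelianVariety ℂ) :
    (IsStablyNondegenerate ((P 0).prod (P 1)) → IsStablyNondegenerate (⨁ P)) ∧
    (IsDivisorGenerated ((P 0).prod (P 1)) → IsDivisorGenerated (⨁ P)) ∧
    ∀ {p : ℕ}, (∃ c : complexBetti (⨁ P).X (2 * p), IsRationalClass c ∧ IsOfHodgeType (⨁ P).dim (⨁ P).X (2 * p) p p c ∧
        c ∉ divisorClassesSpan (⨁ P).X (⨁ P).dim p) →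
      ∃ c : complexBetti ((P 0).prod (P 1)).X (2 * p), IsRationalClass c ∧
        IsOfHodgeType ((P 0).prod (P 1)).dim ((P 0).prod (P 1)).X (2 * p) p p c ∧
        c ∉ divisorClassesSpan ((P 0).prod (P 1)).X ((P 0).prod (P 1)).dim p := by
  let t : (⨁ P) ⟶ (P 0).prod (P 1) := AbelianVariety.prodLift (biproduct.π P 0) (biproduct.π P 1)
  let r : (P 0).prod (P 1) ⟶ ⨁ P :=
    AbelianVariety.fst (P 0) (P 1) ≫ biproduct.ι P 0 + AbelianVariety.snd (P 0) (P 1) ≫ biproduct.ι P 1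
  have htr : t ≫ r = (1 : ℕ) • 𝟙 (⨁ P) := by
    rw [one_smul]
    simp only [t, r, Preadditive.comp_add, ← Category.assoc, AbelianVariety.prodLift_fst, AbelianVariety.prodLift_snd]
    have htot := biproduct.total (f := P)
    rw [Fin.sum_univ_two] at htot
    exact htot
  exact ⟨HodgeTheory.IsStablyNondegenerate.of_comp_eq_nsmul_id t r one_ne_zero htr,
    HodgeTheory.IsDivisorGenerated.of_comp_eq_nsmul_id t r one_ne_zero htr,
    fun hc => exists_exceptional_of_comp_eq_nsmul_id t r one_ne_zero htr hc⟩

variable {lev : Fin 2 → ℕ} [∀ i, NeZero (lev i)] {K : Fin 2 → Type} [∀ i, Field (K i)] [∀ i, NumberField (K i)]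
  [∀ i, IsCyclotomicExtension {lev i} ℚ (K i)] {Φ : ∀ i, CMType (K i)} {A : Fin 2 → AbelianVariety ℂ}
  {ι : ∀ i, 𝓞 (K i) →+* End (A i)} {θ : ∀ i, K i →+* Module.End ℂ (complexBetti (A i).X 1)}

/-- **THE SIMPLE FACTORS OF `X_{16} × X_{48} ⊂ J_{48}`: A SIMPLE CM ABELIAN SURFACE `Y_{16}` AND A SIMPLE CM FOURFOLD `Y_{48}`, BOTH
STABLY NONDEGENERATE, `Hom = 0` BOTH WAYS, WHOSE PRODUCT (DIMENSION `6`) CARRIES A RATIONAL `(2,2)`-CLASS OUTSIDE `𝓓² ⊗ ℂ`.**  For a pair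
of realisations `A_0 ⊨ (ℚ(ζ_{16}); Φ_{16})`, `A_1 ⊨ (ℚ(ζ_{48}); Φ_{48})` of the lower-half types: the primitive sub-pairs
`(L_i; Ψ_i)`, `L_i = ℚ(ζ − ζ^{−1})` of index `2`, have SIMPLE realisations `Y_{16} = B_0` (dim `2`), `Y_{48} = B_1` (dim `4`) with
`A_i ∼ B_i²`; both `B_i` are stably nondegenerate (quasi-retracts of the stably nondegenerate `A_i`, F41); `Hom(B_0, B_1) = 0 = Hom(B_1, B_0)`;
and the exceptional weight `{σ_1, σ_3} ⊔ {σ_{25}, σ_{31}}` of `X_{16} × X_{48}` (F40) restricts injectively to `L_0 ⊔ L_1`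
(`1 + 3 ≢ 8 (16)`, `25 + 31 ≢ 24 (48)`), so descends (§1) to a balanced non-divisorial `4`-subset of `Hom(L_0, ℂ) ⊔ Hom(L_1, ℂ)`:
`B_0 ⊕ B_1` and `B_0 × B_1` carry a rational `(2,2)`-class outside `𝓓² ⊗ ℂ`, are NOT divisor-generated and NOT stably nondegenerate —
although `dim B_1 = 4 ≤ 7` (the tree's PROVED Hazama theorem `IsStablyNondegenerate.prod_of_dim_le_seven` needs its «no type-(IV)
factor» hypothesis even for a simple CM surface times a simple CM fourfold). [cite: Gordon1999HodgeAVSurvey, Thm. 7.6.2 and the remark following it]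
[cite: MoonenZarhin1999LowDim, §3 (3.1)–(3.2)] [cite: GalleseGoodsonLombardo2024, §3 Thm. 3.0 (5)] [cite: Shimura1998, §6.2 Thm. 3 and §8.2 Prop. 26]
[cite: GaoUllmo2025, Thm. 3.1] -/
theorem exists_simpleFactors_exceptional_of_lev_eq_sixteen_fortyEight (h0 : lev 0 = 16) (h1 : lev 1 = 48)
    (hΦ : ∀ i (σ : K i →+* ℂ), σ ∈ (Φ i).1 ↔ 2 * (expOf (lev i) (K i) σ).val < lev i)
    (hA : ∀ i, IsCMTypeRealisation (Φ i) (A i) (ι i) (θ i)) :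
    ∃ (L : ∀ i, IntermediateField ℚ (K i)) (Ψ : ∀ i, CMType (L i)) (B : Fin 2 → AbelianVariety ℂ)
      (ιB : ∀ i, 𝓞 (L i) →+* End (B i)) (θB : ∀ i, L i →+* Module.End ℂ (complexBetti (B i).X 1)),
      (∀ i, inducedCMType (algebraMap (L i) (K i)) (Ψ i) = Φ i) ∧ (∀ i, Module.finrank (L i) (K i) = 2) ∧
      (∀ i, L i = IntermediateField.adjoin ℚ {zetaOf (lev i) (K i) - (zetaOf (lev i) (K i))⁻¹}) ∧
      (∀ i, IsCMTypeRealisation (Ψ i) (B i) (ιB i) (θB i)) ∧ (∀ i, (B i).IsSimple) ∧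
      (∀ i, IsIsogenous (A i) (⨁ fun _ : Fin 2 => B i)) ∧
      (B 0).dim = 2 ∧ (B 1).dim = 4 ∧ IsStablyNondegenerate (B 0) ∧ IsStablyNondegenerate (B 1) ∧
      (∀ u : B 0 ⟶ B 1, u = 0) ∧ (∀ v : B 1 ⟶ B 0, v = 0) ∧
      (pohlmannSetsAlg Ψ 2 \ pohlmannDivisorSetsAlg Ψ 2).Nonempty ∧
      (∃ c : complexBetti (⨁ B).X (2 * 2), IsRationalClass c ∧ IsOfHodgeType (⨁ B).dim (⨁ B).X (2 * 2) 2 2 c ∧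
        c ∉ divisorClassesSpan (⨁ B).X (⨁ B).dim 2) ∧
      ¬IsDivisorGenerated (⨁ B) ∧ ¬IsStablyNondegenerate (⨁ B) ∧ ((B 0).prod (B 1)).dim = 6 ∧
      (∃ c : complexBetti ((B 0).prod (B 1)).X (2 * 2), IsRationalClass c ∧
        IsOfHodgeType ((B 0).prod (B 1)).dim ((B 0).prod (B 1)).X (2 * 2) 2 2 c ∧
        c ∉ divisorClassesSpan ((B 0).prod (B 1)).X ((B 0).prod (B 1)).dim 2) ∧
      ¬IsDivisorGenerated ((B 0).prod (B 1)) ∧ ¬IsStablyNondegenerate ((B 0).prod (B 1)) := by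
  classical
  have hdata : ∀ i : Fin 2, 4 ∣ lev i ∧ 8 ≤ lev i ∧ lev i ≠ 20 ∧ lev i ≠ 24 ∧ lev i ≠ 60 ∧ 2 ∣ lev i ∧ lev i ∣ 48 := by
    refine Fin.forall_fin_two.2 ⟨?_, ?_⟩
    · rw [h0]; norm_num
    · rw [h1]; norm_num
  choose L Ψ B ιB θB t h N hind hfin hL hζ hB hs hdim hiso hN hth using fun i =>
    exists_simpleFactor_retract (hdata i).1 (hdata i).2.1 (hdata i).2.2.1 (hdata i).2.2.2.1 (hdata i).2.2.2.2.1 (hΦ i) (hA i)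
  -- dimensions
  have hd0 : (B 0).dim = 2 := by
    have := hdim 0; rw [h0, show Nat.totient 16 = 8 by decide] at this; omega
  have hd1 : (B 1).dim = 4 := by
    have := hdim 1; rw [h1, show Nat.totient 48 = 16 by decide] at this; omega
  -- stable nondegeneracy of the simple factors (quasi-retracts of the stably nondegenerate pieces)
  have hA0 : IsStablyNondegenerate (A 0) :=
    isStablyNondegenerate_of_level_two_pow (j := 4) (by norm_num) (h0.trans (by norm_num)) (hΦ 0) (hA 0)
  have hA1 : IsStablyNondegenerate (A 1) := isStablyNondegenerate_of_level_fortyEight h1 (hΦ 1) (hA 1)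
  have hB0 : IsStablyNondegenerate (B 0) := HodgeTheory.IsStablyNondegenerate.of_comp_eq_nsmul_id (t 0) (h 0) (hN 0) (hth 0) hA0
  have hB1 : IsStablyNondegenerate (B 1) := HodgeTheory.IsStablyNondegenerate.of_comp_eq_nsmul_id (t 1) (h 1) (hN 1) (hth 1) hA1
  -- orthogonality: simple of different dimensions
  have hu : ∀ u : B 0 ⟶ B 1, u = 0 := HodgeTheory.hom_eq_zero_of_isSimple_of_dim_ne (hs 0) (hs 1) (by omega)
  have hv : ∀ v : B 1 ⟶ B 0, v = 0 := HodgeTheory.hom_eq_zero_of_isSimple_of_dim_ne (hs 1) (hs 0) (by omega)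
  -- the exceptional weight of `X_16 × X_48` (F40) descends to the simple factors
  have hW := weightFortyEight_mem_pohlmannSetsAlg_diff (lev := lev) (K := K) (Φ := Φ) (fun i => (hdata i).2.2.2.2.2.2)
    (i₁ := 0) (i₂ := 1) h0 h1 hΦ
  have hinj := injOn_restrict_weightPair (lev := lev) (K := K) (M := 48) (L := L) (fun i => (hdata i).2.2.2.2.2.1) hζ
    (i₁ := 0) (i₂ := 1) Fin.zero_ne_one h0 h1 (fun t : ZMod 48 => t.val = 3 ∨ t.val = 9) (fun t : ZMod 48 => t.val = 25 ∨ t.val = 31)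
    (by decide) (by decide)
  have hne : (pohlmannSetsAlg Ψ 2 \ pohlmannDivisorSetsAlg Ψ 2).Nonempty := diff_nonempty_subPair_of_injOn hind hW hinj
  obtain ⟨c, hcQ, hcH, hcD⟩ := (exists_exceptional_biproduct_iff hB 2).2 hne
  have hnotD : ¬IsDivisorGenerated (⨁ B) := fun hD => hcD (hD 2 c hcQ hcH)
  have hnotS : ¬IsStablyNondegenerate (⨁ B) := not_isStablyNondegenerate_of_exists_exceptional hcQ hcH hcD
  obtain ⟨hPS, hPD, hPc⟩ := prod_of_biproduct_two B
  have hdimP : ((B 0).prod (B 1)).dim = 6 := by rw [AbelianVariety.dim_prod, hd0, hd1]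
  exact ⟨L, Ψ, B, ιB, θB, hind, hfin, hL, hB, hs, hiso, hd0, hd1, hB0, hB1, hu, hv, hne, ⟨c, hcQ, hcH, hcD⟩, hnotD, hnotS, hdimP,
    hPc ⟨c, hcQ, hcH, hcD⟩, fun hD => hnotD (hPD hD), fun hS => hnotS (hPS hS)⟩

end SimpleFactors

/-! ## §4 The simple factors `E' = Y_8` (a CM elliptic curve) and `Y_{40}` (a simple CM fourfold) of `J_{40}`: `E' × Y_{40}` (dimension `5`) is not stably nondegenerate -/

section EightForty

variable {lev : Fin 2 → ℕ} [∀ i, NeZero (lev i)] {K : Fin 2 → Type} [∀ i, Field (K i)] [∀ i, NumberField (K i)]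
  [∀ i, IsCyclotomicExtension {lev i} ℚ (K i)] {Φ : ∀ i, CMType (K i)} {A : Fin 2 → AbelianVariety ℂ}
  {ι : ∀ i, 𝓞 (K i) →+* End (A i)} {θ : ∀ i, K i →+* Module.End ℂ (complexBetti (A i).X 1)}

/-- **THE SIMPLE FACTORS OF `X_8 × X_{40} ⊂ J_{40}`: A CM ELLIPTIC CURVE `E' = Y_8` (complex multiplication by `ℚ(ζ_8 − ζ_8^{−1}) = ℚ(√−2)`)
AND A SIMPLE CM FOURFOLD `Y_{40}` (by `ℚ(ζ_{40} − ζ_{40}^{−1}) ⊃ ℚ(√−2)`), BOTH STABLY NONDEGENERATE, `Hom = 0` BOTH WAYS, WHOSE PRODUCT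
(DIMENSION `5`) IS NOT STABLY NONDEGENERATE.**  For realisations `A_0 ⊨ (ℚ(ζ_8); Φ_8)`, `A_1 ⊨ (ℚ(ζ_{40}); Φ_{40})`: the simple factors
`B_i ⊨ (L_i; Ψ_i)` with `A_i ∼ B_i²` are stably nondegenerate quasi-retracts of the `A_i` (F41), of dimensions `1` and `4`, orthogonal, and
`B_0 × B_1` is NOT stably nondegenerate: otherwise `B_0² × B_1² ∼ A_0 × A_1` would be (the tree's `IsStablyNondegenerate.powSucc_prod_powSucc`,
isogeny invariance), contradicting the codimension-`3` class on `X_8 × X_{40}` (F40/F41).  This is Moonen–Zarhin's configuration `E × Y`, `Y` a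
simple fourfold of type (IV) with `k = End⁰(E) ↪ End⁰(Y)` acting with multiplicities `(1,3)`: «Rather than looking at `E × Y`, let us look at
`Z := E² × Y` […] the corresponding space of Weil classes `W_k ⊂ H⁶(Z, ℚ)` consists of Hodge classes» — made explicit inside `J_{40}`.
[cite: MoonenZarhin1999LowDim, §3 (3.1)–(3.2), Prop. (3.8) and §5 (Case 2)] [cite: Gordon1999HodgeAVSurvey, Thm. 7.6.2 and the remark following it]
[cite: GalleseGoodsonLombardo2024, §3 Thm. 3.0 (5)] [cite: Shimura1998, §6.2 Thm. 3 and §8.2 Prop. 26] -/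
theorem exists_simpleFactors_of_lev_eq_eight_forty (h0 : lev 0 = 8) (h1 : lev 1 = 40)
    (hΦ : ∀ i (σ : K i →+* ℂ), σ ∈ (Φ i).1 ↔ 2 * (expOf (lev i) (K i) σ).val < lev i)
    (hA : ∀ i, IsCMTypeRealisation (Φ i) (A i) (ι i) (θ i)) :
    ∃ (L : ∀ i, IntermediateField ℚ (K i)) (Ψ : ∀ i, CMType (L i)) (B : Fin 2 → AbelianVariety ℂ)
      (ιB : ∀ i, 𝓞 (L i) →+* End (B i)) (θB : ∀ i, L i →+* Module.End ℂ (complexBetti (B i).X 1)),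
      (∀ i, inducedCMType (algebraMap (L i) (K i)) (Ψ i) = Φ i) ∧ (∀ i, Module.finrank (L i) (K i) = 2) ∧
      (∀ i, L i = IntermediateField.adjoin ℚ {zetaOf (lev i) (K i) - (zetaOf (lev i) (K i))⁻¹}) ∧
      (∀ i, IsCMTypeRealisation (Ψ i) (B i) (ιB i) (θB i)) ∧ (∀ i, (B i).IsSimple) ∧
      (∀ i, IsIsogenous (A i) (⨁ fun _ : Fin 2 => B i)) ∧
      (B 0).dim = 1 ∧ (B 1).dim = 4 ∧ IsStablyNondegenerate (B 0) ∧ IsStablyNondegenerate (B 1) ∧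
      (∀ u : B 0 ⟶ B 1, u = 0) ∧ (∀ v : B 1 ⟶ B 0, v = 0) ∧ ((B 0).prod (B 1)).dim = 5 ∧
      ¬IsStablyNondegenerate ((B 0).prod (B 1)) := by
  classical
  have hdata : ∀ i : Fin 2, 4 ∣ lev i ∧ 8 ≤ lev i ∧ lev i ≠ 20 ∧ lev i ≠ 24 ∧ lev i ≠ 60 := by
    refine Fin.forall_fin_two.2 ⟨?_, ?_⟩
    · rw [h0]; norm_num
    · rw [h1]; norm_num
  choose L Ψ B ιB θB t h N hind hfin hL hζ hB hs hdim hiso hN hth using fun i =>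
    exists_simpleFactor_retract (hdata i).1 (hdata i).2.1 (hdata i).2.2.1 (hdata i).2.2.2.1 (hdata i).2.2.2.2 (hΦ i) (hA i)
  have hd0 : (B 0).dim = 1 := by
    have := hdim 0; rw [h0, show Nat.totient 8 = 4 by decide] at this; omega
  have hd1 : (B 1).dim = 4 := by
    have := hdim 1; rw [h1, show Nat.totient 40 = 16 by decide] at this; omega
  have hA0 : IsStablyNondegenerate (A 0) :=
    isStablyNondegenerate_of_level_two_pow (j := 3) (by norm_num) (h0.trans (by norm_num)) (hΦ 0) (hA 0)
  have hA1 : IsStablyNondegenerate (A 1) := isStablyNondegenerate_of_level_forty h1 (hΦ 1) (hA 1)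
  have hB0 : IsStablyNondegenerate (B 0) := HodgeTheory.IsStablyNondegenerate.of_comp_eq_nsmul_id (t 0) (h 0) (hN 0) (hth 0) hA0
  have hB1 : IsStablyNondegenerate (B 1) := HodgeTheory.IsStablyNondegenerate.of_comp_eq_nsmul_id (t 1) (h 1) (hN 1) (hth 1) hA1
  have hu : ∀ u : B 0 ⟶ B 1, u = 0 := HodgeTheory.hom_eq_zero_of_isSimple_of_dim_ne (hs 0) (hs 1) (by omega)
  have hv : ∀ v : B 1 ⟶ B 0, v = 0 := HodgeTheory.hom_eq_zero_of_isSimple_of_dim_ne (hs 1) (hs 0) (by omega)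
  -- F41: `A_0 × A_1` is not stably nondegenerate; `A_0 × A_1 ∼ B_0² × B_1²`
  obtain ⟨-, -, -, -, -, -, -, -, -, -, -, hAP⟩ :=
    stablyNondegenerate_orthogonal_exceptional_of_lev_eq_eight_forty (lev := lev) (C := A) hΦ hA (j₁ := 0) (j₂ := 1) h0 h1
  have hprod : IsIsogenous ((A 0).prod (A 1)) (((B 0).powSucc 1).prod ((B 1).powSucc 1)) :=
    ((hiso 0).trans (isIsogenous_powSucc_biproduct (B 0) 1).symm').prod
      ((hiso 1).trans (isIsogenous_powSucc_biproduct (B 1) 1).symm')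
  have hnot : ¬IsStablyNondegenerate ((B 0).prod (B 1)) := fun hP =>
    hAP ((hP.powSucc_prod_powSucc 1 1).of_isIsogenous hprod)
  have hdimP : ((B 0).prod (B 1)).dim = 5 := by rw [AbelianVariety.dim_prod, hd0, hd1]
  exact ⟨L, Ψ, B, ιB, θB, hind, hfin, hL, hB, hs, hiso, hd0, hd1, hB0, hB1, hu, hv, hdimP, hnot⟩

end EightForty

/-! ## §5 Hypothesis-free: simple, stably nondegenerate, mutually orthogonal CM factors of dimensions `(1,4)` and `(2,4)` with degenerate products -/

section Existence

/-- **THE FIVE-DIMENSIONAL EXAMPLE EXISTS**: a CM elliptic curve `E` (complex multiplication by `ℚ(√−2) = ℚ(ζ_8 − ζ_8^{−1})`) and a SIMPLE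
abelian fourfold `Y` with complex multiplication by `ℚ(ζ_{40} − ζ_{40}^{−1})`, both stably nondegenerate, `Hom(E, Y) = 0 = Hom(Y, E)`, with
`E × Y` (dimension `5`) NOT stably nondegenerate — Moonen–Zarhin's case (g) (`B•(E × Y) = D•(E × Y)` but `Hg(E × Y) ≠ Hg(E) × Hg(Y)`, Weil
classes on `E² × Y`), realised inside `J_{40}` (`X_8 × X_{40} ∼ E² × Y²`). [cite: MoonenZarhin1999LowDim, §3 (3.1), Prop. (3.8) and §5 (Case 2)]
[cite: Gordon1999HodgeAVSurvey, Thm. 7.6.2 and the remark following it] [cite: Shimura1998, §6.2 Thm. 3 and §8.2 Prop. 26] -/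
theorem exists_cmCurve_simple_fourfold_not_isStablyNondegenerate_prod :
    ∃ E Y : AbelianVariety ℂ, E.IsSimple ∧ Y.IsSimple ∧ E.dim = 1 ∧ Y.dim = 4 ∧
      IsStablyNondegenerate E ∧ IsStablyNondegenerate Y ∧ (∀ u : E ⟶ Y, u = 0) ∧ (∀ v : Y ⟶ E, v = 0) ∧
      (E.prod Y).dim = 5 ∧ ¬IsStablyNondegenerate (E.prod Y) := by
  obtain ⟨K, _, _, _, _, Φ, A, ι, θ, hΦ, hA⟩ := exists_realisation_family (![8, 40] : Fin 2 → ℕ)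
    (fun i => by fin_cases i <;> decide) (fun i => by fin_cases i <;> decide)
  obtain ⟨L, Ψ, B, ιB, θB, -, -, -, -, hs, -, hd0, hd1, hB0, hB1, hu, hv, hdimP, hS⟩ :=
    exists_simpleFactors_of_lev_eq_eight_forty (lev := (![8, 40] : Fin 2 → ℕ)) (A := A) rfl rfl hΦ hA
  exact ⟨B 0, B 1, hs 0, hs 1, hd0, hd1, hB0, hB1, hu, hv, hdimP, hS⟩

/-- **THE SIX-DIMENSIONAL EXAMPLE EXISTS**: a SIMPLE abelian surface `Y` with complex multiplication by the cyclic quartic CM field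
`ℚ(ζ_{16} − ζ_{16}^{−1})` and a SIMPLE abelian fourfold `Z` with complex multiplication by `ℚ(ζ_{48} − ζ_{48}^{−1})`, both stably
nondegenerate (`B = D` on all their powers), `Hom(Y, Z) = 0 = Hom(Z, Y)`, such that `Y × Z` (dimension `6`) carries a rational
`(2,2)`-class outside `𝓓² ⊗ ℂ`; `Y × Z` is not divisor-generated and not stably nondegenerate (`Hg(Y × Z) ≠ Hg(Y) × Hg(Z)`, Moonen–Zarhin
(3.1)).  In dimension `≤ 5` Moonen–Zarhin's classification leaves no such pair of simple CM factors with an exceptional class ON THE PRODUCT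
(their (5.?)–(5.?): `Y_1 × Y_2`, `Y_1` a simple CM surface, `Y_2` a simple CM threefold, has `Hg = Hg(Y_1) × Hg(Y_2)`; `E × Y` in case (g)
has `B• = D•`); this is the simple-factor sharpening of F41 (`X_{16} × X_{48} ∼ (Y × Z)²`). [cite: MoonenZarhin1999LowDim, §3 (3.1)–(3.2) and §5]
[cite: Gordon1999HodgeAVSurvey, Thm. 7.6.2 and the remark following it] [cite: Shimura1998, §6.2 Thm. 3 and §8.2 Prop. 26]
[cite: GalleseGoodsonLombardo2024, §3 Thm. 3.0 (5)] -/
theorem exists_simple_surface_fourfold_exceptional_prod :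
    ∃ Y Z : AbelianVariety ℂ, Y.IsSimple ∧ Z.IsSimple ∧ Y.dim = 2 ∧ Z.dim = 4 ∧
      IsStablyNondegenerate Y ∧ IsStablyNondegenerate Z ∧ (∀ u : Y ⟶ Z, u = 0) ∧ (∀ v : Z ⟶ Y, v = 0) ∧
      (Y.prod Z).dim = 6 ∧
      (∃ c : complexBetti (Y.prod Z).X (2 * 2), IsRationalClass c ∧ IsOfHodgeType (Y.prod Z).dim (Y.prod Z).X (2 * 2) 2 2 c ∧
        c ∉ divisorClassesSpan (Y.prod Z).X (Y.prod Z).dim 2) ∧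
      ¬IsDivisorGenerated (Y.prod Z) ∧ ¬IsStablyNondegenerate (Y.prod Z) := by
  obtain ⟨K, _, _, _, _, Φ, A, ι, θ, hΦ, hA⟩ := exists_realisation_family (![16, 48] : Fin 2 → ℕ)
    (fun i => by fin_cases i <;> decide) (fun i => by fin_cases i <;> decide)
  obtain ⟨L, Ψ, B, ιB, θB, -, -, -, -, hs, -, hd0, hd1, hB0, hB1, hu, hv, -, -, -, -, hdimP, hc, hD, hS⟩ :=
    exists_simpleFactors_exceptional_of_lev_eq_sixteen_fortyEight (lev := (![16, 48] : Fin 2 → ℕ)) (A := A) rfl rfl hΦ hA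
  exact ⟨B 0, B 1, hs 0, hs 1, hd0, hd1, hB0, hB1, hu, hv, hdimP, hc, hD, hS⟩

/-- **STABLE NONDEGENERACY IS NOT INHERITED BY PRODUCTS OF SIMPLE, MUTUALLY ORTHOGONAL FACTORS — NOT EVEN BY AN ELLIPTIC CURVE TIMES A
SIMPLE FOURFOLD**: the «no type-(IV) factor» hypothesis of Hazama's product theorem (Gordon 7.6.2; the tree's named fact
`Hazama1989_stablyNondegenerate_prod` and its PROVED low-dimensional form `IsStablyNondegenerate.prod_of_dim_le_seven`) cannot be dropped for
SIMPLE factors of dimensions `1` and `4`. [cite: Gordon1999HodgeAVSurvey, Thm. 7.6.2 and the remark following it]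
[cite: MoonenZarhin1999LowDim, §3 (3.1)–(3.2) and Prop. (3.8)] -/
theorem not_forall_isSimple_isStablyNondegenerate_prod :
    ¬∀ E Y : AbelianVariety ℂ, E.IsSimple → Y.IsSimple → E.dim = 1 → Y.dim = 4 → IsStablyNondegenerate E → IsStablyNondegenerate Y →
      (∀ u : E ⟶ Y, u = 0) → (∀ v : Y ⟶ E, v = 0) → IsStablyNondegenerate (E.prod Y) := by
  intro h
  obtain ⟨E, Y, hE, hY, hdE, hdY, hsE, hsY, hu, hv, -, hS⟩ := exists_cmCurve_simple_fourfold_not_isStablyNondegenerate_prod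
  exact hS (h E Y hE hY hdE hdY hsE hsY hu hv)

/-- **NOR BY A SIMPLE SURFACE TIMES A SIMPLE FOURFOLD, WITH `B² ≠ D²` ON THE PRODUCT ITSELF**: it is false that `B²(Y × Z) = D²(Y × Z)`
(every rational `(2,2)`-class in `𝓓² ⊗ ℂ`) for all simple, stably nondegenerate, mutually orthogonal `Y`, `Z` of dimensions `2` and `4`.
[cite: Gordon1999HodgeAVSurvey, Thm. 7.6.2 and the remark following it] [cite: MoonenZarhin1999LowDim, §3 (3.1)–(3.2) and §5] -/
theorem not_forall_isSimple_surface_fourfold_codimTwo :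
    ¬∀ Y Z : AbelianVariety ℂ, Y.IsSimple → Z.IsSimple → Y.dim = 2 → Z.dim = 4 → IsStablyNondegenerate Y → IsStablyNondegenerate Z →
      (∀ u : Y ⟶ Z, u = 0) → (∀ v : Z ⟶ Y, v = 0) →
      ∀ c : complexBetti (Y.prod Z).X (2 * 2), IsRationalClass c → IsOfHodgeType (Y.prod Z).dim (Y.prod Z).X (2 * 2) 2 2 c →
        c ∈ divisorClassesSpan (Y.prod Z).X (Y.prod Z).dim 2 := by
  intro h
  obtain ⟨Y, Z, hY, hZ, hdY, hdZ, hsY, hsZ, hu, hv, -, ⟨c, hcQ, hcH, hcD⟩, -, -⟩ := exists_simple_surface_fourfold_exceptional_prod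
  exact hcD (h Y Z hY hZ hdY hdZ hsY hsZ hu hv c hcQ hcH)

end Existence

end HyperellipticJacobian

end Literature.AlgebraicGeometry.ComplexMultiplication
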